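import Summits.Ventures.PercRepro.C025ProfilePavingPLD

/-!
# C-025 ON EVERY TRUNCATION AT A LEVEL ≤ GIRTH OF «ANY MATROID PLUS FREE POINTS» (night-3 g28)

`proofs/NIGHT3-G28-PAVING.md` §3(a).  For a finite matroid `M` whose circuits all have at least `g` points (girth `≥ g`)
the truncation `truncate M g` is PAVING (`truncate_paving_of_girth`: a circuit of the truncation is either an `M`-circuit,
with `≥ g` points, or an independent set of `g + 1` points; the rank of the truncation is `≤ g`), and for `r ≤ g` the
truncation to rank `r` of `M ⊕ N` coincides with that of `truncate M g ⊕ N` (`truncate_disjointSum_truncate`: both have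
the independent sets `I` with `I ∩ E_M` and `I ∩ E_N` independent and `|I| ≤ r ≤ g`).  So `PavingPLD.rls_truncate_disjointSum_freeOn_of_paving`
applied to `truncate M g` gives **C-025 at every `(p, q)` on every truncation at a level `r ≤ g` of `M ⊕ freeOn E₃`, for EVERY
finite matroid `M` of girth `≥ g`** (`rls_truncate_disjointSum_freeOn_of_girth`).  A paving matroid is the case `g = ρ(E)`.
No `def`, no `instance`, no notation.  Axioms: standard.
-/

open scoped Matroid

namespace PercRepro

open Finset ThmH

namespace PavingPLD

variable {α : Type} [DecidableEq α]

omit [DecidableEq α] in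
/-- **The truncation at the girth is paving**: if every circuit of `M` has at least `g` points, every circuit of
`truncate M g` has at least `ρ(truncate M g) ≤ g` points. -/
theorem truncate_paving_of_girth (M : Matroid α) [M.Finite] (g : ℕ)
    (hg : ∀ C, M.IsCircuit C → (g : ℕ∞) ≤ C.encard) :
    ∀ C, (Matroid.truncate M g).IsCircuit C → (Matroid.truncate M g).eRank ≤ C.encard := by
  intro C hC
  have hle : (Matroid.truncate M g).eRank ≤ (g : ℕ∞) := by
    rw [Matroid.truncate_eRank]; exact min_le_right _ _
  refine hle.trans ?_
  have hCE : C ⊆ M.E := by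
    have := hC.subset_ground
    rwa [Matroid.truncate_ground] at this
  have hCfin : C.Finite := M.ground_finite.subset hCE
  have hdep := hC.dep.not_indep
  rw [Matroid.truncate_indep_iff] at hdep
  by_cases hcard : C.ncard ≤ g
  · have hind : ¬ M.Indep C := fun h => hdep ⟨h, hcard⟩
    obtain ⟨C', hC'C, hC'⟩ := ((M.not_indep_iff hCE).1 hind).exists_isCircuit_subset
    exact (hg C' hC').trans (Set.encard_le_encard hC'C)
  · rw [not_le] at hcard
    rw [← hCfin.cast_ncard_eq]
    exact_mod_cast hcard.le

omit [DecidableEq α] in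
/-- If every circuit of `M` has at least `g` points, a set of rank `≤ g − 2` is independent. -/
theorem indep_of_toNat_eRk_add_two_le_of_girth (M : Matroid α) [M.Finite] (g : ℕ)
    (hg : ∀ C, M.IsCircuit C → (g : ℕ∞) ≤ C.encard) (X : Set α) (hX : X ⊆ M.E)
    (h : (M.eRk X).toNat + 2 ≤ g) : M.Indep X := by
  by_contra hind
  obtain ⟨C, hCX, hC⟩ := ((M.not_indep_iff hX).1 hind).exists_isCircuit_subset
  have h1 : (g : ℕ∞) ≤ M.eRk C + 1 := by rw [hC.eRk_add_one_eq]; exact hg C hC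
  have h2 : M.eRk C ≤ M.eRk X := M.eRk_mono hCX
  obtain ⟨x, hx⟩ : ∃ x : ℕ, M.eRk X = x := ⟨_, (ENat.coe_toNat (eRk_ne_top M _)).symm⟩
  rw [hx, ENat.toNat_coe] at h
  rw [hx] at h2
  have h3 : (g : ℕ∞) ≤ (x : ℕ∞) + 1 := h1.trans (add_le_add h2 (le_refl 1))
  have h4 : g ≤ x + 1 := by exact_mod_cast h3
  omega

/-- **The natural image of a residual source below the girth** (`residual_facts` with the girth in place of the
rank): for `hi + δ < g` a residual source `(I, D)` of any finite matroid whose circuits have `≥ g` points has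
`ρ(I ∪ D) = ρ(I) + δ`, `D ⊆ K(I ∪ D)` and `ρ(E ∖ (I ∪ D)) ≥ hi + 1`. -/
theorem residual_facts_of_girth (M : Matroid α) [M.Finite] (g : ℕ)
    (hg : ∀ C, M.IsCircuit C → (g : ℕ∞) ≤ C.encard) (K : Finset α → Finset α)
    (hK : ∀ X, K X ⊆ X ∧ M.Indep (K X : Set α) ∧ (K X).card = (M.eRk (X : Set α)).toNat)
    {hi δ : ℕ} (hbound : hi + δ < g) {I D : Finset α} (hI : I ⊆ gr M) (hx : (M.eRk (I : Set α)).toNat ≤ hi)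
    (hf : hi + δ + 1 ≤ (M.eRk ((gr M \ I : Finset α) : Set α)).toNat)
    (hD : D ∈ powersetCard δ (K (gr M \ I))) :
    (M.eRk ((I ∪ D : Finset α) : Set α)).toNat = (M.eRk (I : Set α)).toNat + δ ∧
    D ⊆ K (I ∪ D) ∧
    hi + 1 ≤ (M.eRk ((gr M \ (I ∪ D) : Finset α) : Set α)).toNat := by
  rw [mem_powersetCard] at hD
  obtain ⟨hDK, hDcard⟩ := hD
  have hDE : D ⊆ gr M \ I := hDK.trans (hK _).1
  have hDI : Disjoint I D := disjoint_of_subset_right hDE sdiff_disjoint.symm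
  have hC : hi + 1 ≤ (M.eRk ((gr M \ (I ∪ D) : Finset α) : Set α)).toNat := by
    have h1 := toNat_eRk_le_toNat_eRk_sdiff_add_card M (gr M \ I) D
    have h2 : (gr M \ I) \ D = gr M \ (I ∪ D) := by
      ext a
      simp only [mem_sdiff, mem_union]
      tauto
    rw [h2] at h1
    omega
  rcases Nat.eq_zero_or_pos δ with hδ | hδ
  · subst hδ
    have hD0 : D = ∅ := card_eq_zero.1 hDcard
    subst hD0
    exact ⟨by simp, by simp, hC⟩
  · have hIind : M.Indep (I : Set α) := by
      apply indep_of_toNat_eRk_add_two_le_of_girth M g hg _ (by rw [← coe_gr]; exact coe_subset.2 hI)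
      omega
    have hIcard : I.card = (M.eRk (I : Set α)).toNat := by
      rw [hIind.eRk_eq_encard, Set.encard_coe_eq_coe_finsetCard, ENat.toNat_coe]
    have hUcard : (I ∪ D).card = (M.eRk (I : Set α)).toNat + δ := by
      rw [card_union_of_disjoint hDI, hIcard, hDcard]
    have hUE : I ∪ D ⊆ gr M := union_subset hI (hDE.trans sdiff_subset)
    have hUind : M.Indep ((I ∪ D : Finset α) : Set α) := by
      apply PavingRows.indep_of_encard_le_of_circuits hg (q := (I ∪ D).card) (by rw [hUcard]; omega)
      · rw [← coe_gr]; exact coe_subset.2 hUE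
      · rw [Set.encard_coe_eq_coe_finsetCard]
    have hA : (M.eRk ((I ∪ D : Finset α) : Set α)).toNat = (M.eRk (I : Set α)).toNat + δ := by
      rw [hUind.eRk_eq_encard, Set.encard_coe_eq_coe_finsetCard, ENat.toNat_coe, hUcard]
    refine ⟨hA, ?_, hC⟩
    have hKeq : K (I ∪ D) = I ∪ D := by
      apply eq_of_subset_of_card_le (hK _).1
      rw [(hK _).2.2, hA, hUcard]
    rw [hKeq]
    exact subset_union_right

/-- **The injection `RS → THI` below the girth** (`card_residual_le_card_high` with the girth in place of the rank). -/
theorem card_residual_le_card_high_of_girth (M : Matroid α) [M.Finite] (g : ℕ)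
    (hg : ∀ C, M.IsCircuit C → (g : ℕ∞) ≤ C.encard) (K : Finset α → Finset α)
    (hK : ∀ X, K X ⊆ X ∧ M.Indep (K X : Set α) ∧ (K X).card = (M.eRk (X : Set α)).toNat)
    (lo hi δ : ℕ) (hbound : hi + δ < g) :
    (((gr M).powerset.filter (fun I : Finset α => lo ≤ (M.eRk (I : Set α)).toNat ∧ (M.eRk (I : Set α)).toNat ≤ hi ∧
        hi + δ + 1 ≤ (M.eRk ((gr M \ I : Finset α) : Set α)).toNat)).sigma
      (fun I : Finset α => powersetCard δ (K (gr M \ I)))).card ≤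
    (((gr M).powerset.filter (fun J : Finset α => lo + δ ≤ (M.eRk ((gr M \ J : Finset α) : Set α)).toNat ∧
        (M.eRk ((gr M \ J : Finset α) : Set α)).toNat ≤ hi + δ ∧ hi + 1 ≤ (M.eRk (J : Set α)).toNat)).sigma
      (fun J : Finset α => powersetCard δ (K (gr M \ J)))).card := by
  apply card_le_card_of_injOn (fun p => (⟨gr M \ (p.1 ∪ p.2), p.2⟩ : Σ _ : Finset α, Finset α))
  · intro p hp
    rw [mem_coe, mem_sigma, mem_filter, mem_powerset] at hp
    obtain ⟨⟨hI, hlo, hhi, hf⟩, hD⟩ := hp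
    obtain ⟨hA, hB, hC⟩ := residual_facts_of_girth M g hg K hK hbound hI hhi hf hD
    have hUE : p.1 ∪ p.2 ⊆ gr M := by
      rw [mem_powersetCard] at hD
      exact union_subset hI ((hD.1.trans (hK _).1).trans sdiff_subset)
    rw [mem_coe, mem_sigma, mem_filter, mem_powerset]
    refine ⟨⟨sdiff_subset, ?_⟩, ?_⟩
    · rw [Finset.sdiff_sdiff_eq_self hUE, hA]
      exact ⟨by omega, by omega, hC⟩
    · rw [Finset.sdiff_sdiff_eq_self hUE, mem_powersetCard]
      rw [mem_powersetCard] at hD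
      exact ⟨hB, hD.2⟩
  · intro p hp q hq hpq
    rw [mem_coe, mem_sigma, mem_filter, mem_powerset] at hp hq
    obtain ⟨⟨hIp, -, -, -⟩, hDp⟩ := hp
    obtain ⟨⟨hIq, -, -, -⟩, hDq⟩ := hq
    rw [mem_powersetCard] at hDp hDq
    have hDpE : p.2 ⊆ gr M \ p.1 := hDp.1.trans (hK _).1
    have hDqE : q.2 ⊆ gr M \ q.1 := hDq.1.trans (hK _).1
    have hUp : p.1 ∪ p.2 ⊆ gr M := union_subset hIp (hDpE.trans sdiff_subset)
    have hUq : q.1 ∪ q.2 ⊆ gr M := union_subset hIq (hDqE.trans sdiff_subset)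
    simp only [Sigma.mk.inj_iff, heq_eq_eq] at hpq
    obtain ⟨h1, h2⟩ := hpq
    have h3 : p.1 ∪ p.2 = q.1 ∪ q.2 := by
      rw [← Finset.sdiff_sdiff_eq_self hUp, ← Finset.sdiff_sdiff_eq_self hUq, h1]
    have h4 : p.1 = q.1 := by
      have hp' : p.1 = (p.1 ∪ p.2) \ p.2 :=
        (union_sdiff_cancel_right (disjoint_of_subset_right hDpE sdiff_disjoint.symm)).symm
      have hq' : q.1 = (q.1 ∪ q.2) \ q.2 :=
        (union_sdiff_cancel_right (disjoint_of_subset_right hDqE sdiff_disjoint.symm)).symm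
      rw [hp', hq', h3, h2]
    exact Sigma.ext h4 (heq_of_eq h2)

/-- **PER-LAYER DOMINANCE BELOW THE GIRTH ON EVERY FINITE MATROID**: if every circuit of `M` has at least `g` points,
then (PLD)`[lo, hi, δ; Θ]` holds whenever `hi + δ < g` (a paving matroid is the case `g = ρ(E)`, where the bound is
automatic). -/
theorem pld_of_girth (M : Matroid α) [M.Finite] (g : ℕ)
    (hg : ∀ C, M.IsCircuit C → (g : ℕ∞) ≤ C.encard) :
    ∀ lo hi δ Θ : ℕ, hi + δ < g → Θ ≤ lo + hi + δ → (lo = 0 ∨ lo + hi + δ ≤ Θ) →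
      (∑ I ∈ (gr M).powerset, (if lo ≤ (M.eRk (I : Set α)).toNat ∧ (M.eRk (I : Set α)).toNat ≤ hi ∧
          Θ ≤ (M.eRk ((gr M \ I : Finset α) : Set α)).toNat + (M.eRk (I : Set α)).toNat then
          ((M.eRk ((gr M \ I : Finset α) : Set α)).toNat).choose δ else 0)) ≤
        ∑ I ∈ (gr M).powerset, (if lo + δ ≤ (M.eRk ((gr M \ I : Finset α) : Set α)).toNat ∧
          (M.eRk ((gr M \ I : Finset α) : Set α)).toNat ≤ hi + δ then
          ((M.eRk ((gr M \ I : Finset α) : Set α)).toNat).choose δ else 0) := by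
  intro lo hi δ Θ hbound hΘ hside
  choose K hK using exists_indep_subset_card_eq M
  have hL : (∑ I ∈ (gr M).powerset, (if lo ≤ (M.eRk (I : Set α)).toNat ∧ (M.eRk (I : Set α)).toNat ≤ hi ∧
          Θ ≤ (M.eRk ((gr M \ I : Finset α) : Set α)).toNat + (M.eRk (I : Set α)).toNat then
          ((M.eRk ((gr M \ I : Finset α) : Set α)).toNat).choose δ else 0)) =
      (∑ I ∈ (gr M).powerset, (if lo ≤ (M.eRk (I : Set α)).toNat ∧ (M.eRk (I : Set α)).toNat ≤ hi ∧
          Θ ≤ (M.eRk ((gr M \ I : Finset α) : Set α)).toNat + (M.eRk (I : Set α)).toNat ∧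
          (M.eRk ((gr M \ I : Finset α) : Set α)).toNat ≤ hi + δ then
          ((M.eRk ((gr M \ I : Finset α) : Set α)).toNat).choose δ else 0)) +
      (∑ I ∈ (gr M).powerset, (if lo ≤ (M.eRk (I : Set α)).toNat ∧ (M.eRk (I : Set α)).toNat ≤ hi ∧
          hi + δ + 1 ≤ (M.eRk ((gr M \ I : Finset α) : Set α)).toNat then
          ((M.eRk ((gr M \ I : Finset α) : Set α)).toNat).choose δ else 0)) := by
    rw [← sum_add_distrib]
    apply sum_congr rfl
    intro I _
    split_ifs <;> omega
  have hR : (∑ I ∈ (gr M).powerset, (if lo + δ ≤ (M.eRk ((gr M \ I : Finset α) : Set α)).toNat ∧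
          (M.eRk ((gr M \ I : Finset α) : Set α)).toNat ≤ hi + δ then
          ((M.eRk ((gr M \ I : Finset α) : Set α)).toNat).choose δ else 0)) =
      (∑ I ∈ (gr M).powerset, (if lo + δ ≤ (M.eRk ((gr M \ I : Finset α) : Set α)).toNat ∧
          (M.eRk ((gr M \ I : Finset α) : Set α)).toNat ≤ hi + δ ∧ (M.eRk (I : Set α)).toNat ≤ hi then
          ((M.eRk ((gr M \ I : Finset α) : Set α)).toNat).choose δ else 0)) +
      (∑ I ∈ (gr M).powerset, (if lo + δ ≤ (M.eRk ((gr M \ I : Finset α) : Set α)).toNat ∧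
          (M.eRk ((gr M \ I : Finset α) : Set α)).toNat ≤ hi + δ ∧ hi + 1 ≤ (M.eRk (I : Set α)).toNat then
          ((M.eRk ((gr M \ I : Finset α) : Set α)).toNat).choose δ else 0)) := by
    rw [← sum_add_distrib]
    apply sum_congr rfl
    intro I _
    split_ifs <;> omega
  rw [hL, hR]
  apply Nat.add_le_add
  · apply sum_le_sum
    intro I _
    split_ifs with h1 h2
    · exact le_rfl
    · apply Nat.le_of_eq
      apply Nat.choose_eq_zero_of_lt
      omega
    · exact Nat.zero_le _
    · exact le_rfl
  · rw [← sum_filter, ← sum_filter]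
    have e1 : ∀ s : Finset (Finset α), ∑ I ∈ s, ((M.eRk ((gr M \ I : Finset α) : Set α)).toNat).choose δ =
        (s.sigma (fun I : Finset α => powersetCard δ (K (gr M \ I)))).card := by
      intro s
      rw [card_sigma]
      apply sum_congr rfl
      intro I _
      rw [card_powersetCard, (hK _).2.2]
    rw [e1, e1]
    exact card_residual_le_card_high_of_girth M g hg K hK lo hi δ hbound

omit [DecidableEq α] in
/-- **Truncating below the girth level commutes with truncating `M` at the girth**: for `r ≤ g`,
`truncate (M ⊕ N) r = truncate (truncate M g ⊕ N) r`. -/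
theorem truncate_disjointSum_truncate (M N : Matroid α) [M.Finite] [N.Finite] (g r : ℕ) (hr : r ≤ g)
    (h : Disjoint M.E N.E) (h' : Disjoint (Matroid.truncate M g).E N.E) :
    haveI : (M.disjointSum N h).Finite :=
      ⟨by rw [Matroid.disjointSum_ground_eq]; exact M.ground_finite.union N.ground_finite⟩
    haveI : ((Matroid.truncate M g).disjointSum N h').Finite :=
      ⟨by rw [Matroid.disjointSum_ground_eq, Matroid.truncate_ground]; exact M.ground_finite.union N.ground_finite⟩
    Matroid.truncate (M.disjointSum N h) r = Matroid.truncate ((Matroid.truncate M g).disjointSum N h') r := by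
  haveI : (M.disjointSum N h).Finite :=
    ⟨by rw [Matroid.disjointSum_ground_eq]; exact M.ground_finite.union N.ground_finite⟩
  haveI : ((Matroid.truncate M g).disjointSum N h').Finite :=
    ⟨by rw [Matroid.disjointSum_ground_eq, Matroid.truncate_ground]; exact M.ground_finite.union N.ground_finite⟩
  apply Matroid.ext_indep
  · rw [Matroid.truncate_ground, Matroid.truncate_ground, Matroid.disjointSum_ground_eq,
      Matroid.disjointSum_ground_eq, Matroid.truncate_ground]
  · intro I hI
    have hIfin : I.Finite := by
      rw [Matroid.truncate_ground, Matroid.disjointSum_ground_eq] at hI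
      exact (M.ground_finite.union N.ground_finite).subset hI
    simp only [Matroid.truncate_indep_iff, Matroid.disjointSum_indep_iff, Matroid.truncate_ground]
    constructor
    · rintro ⟨⟨h1, h2, h3⟩, h4⟩
      refine ⟨⟨⟨h1, ?_⟩, h2, h3⟩, h4⟩
      calc (I ∩ M.E).ncard ≤ I.ncard := Set.ncard_le_ncard Set.inter_subset_left hIfin
        _ ≤ r := h4
        _ ≤ g := hr
    · rintro ⟨⟨⟨h1, -⟩, h2, h3⟩, h4⟩
      exact ⟨⟨h1, h2, h3⟩, h4⟩

/-- **C-025 AT EVERY `(p, q)` ON EVERY TRUNCATION AT A LEVEL `≤ GIRTH` OF «ANY MATROID PLUS FREE POINTS»**: for every finite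
matroid `M` all of whose circuits have at least `g` points, every finite `E₃` disjoint from `E_M`, every `r ≤ g` and every
`(p, q)`, `ThmN.RLS (truncate (M ⊕ freeOn E₃) r) p q`. -/
theorem rls_truncate_disjointSum_freeOn_of_girth (M : Matroid α) [M.Finite] (g : ℕ)
    (hg : ∀ C, M.IsCircuit C → (g : ℕ∞) ≤ C.encard) (E₃ : Finset α)
    (h : Disjoint M.E (E₃ : Set α)) (r : ℕ) (hr : r ≤ g) (p q : ℕ) :
    haveI := PLDBridge.disjointSum_freeOn_finite M E₃ h
    ThmN.RLS (Matroid.truncate (M.disjointSum (Matroid.freeOn (E₃ : Set α)) h) r) p q := by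
  haveI := PLDBridge.disjointSum_freeOn_finite M E₃ h
  have h' : Disjoint (Matroid.truncate M g).E (E₃ : Set α) := by rwa [Matroid.truncate_ground]
  haveI := PLDBridge.disjointSum_freeOn_finite (Matroid.truncate M g) E₃ h'
  haveI : (Matroid.freeOn (E₃ : Set α)).Finite := ⟨by rw [Matroid.freeOn_ground]; exact E₃.finite_toSet⟩
  have key := rls_truncate_disjointSum_freeOn_of_paving (Matroid.truncate M g)
    (truncate_paving_of_girth M g hg) E₃ h' r p q
  have heq := truncate_disjointSum_truncate M (Matroid.freeOn (E₃ : Set α)) g r hr h h'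
  convert key using 2

end PavingPLD

end PercRepro
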